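import Mathlib.LinearAlgebra.FiniteDimensional.Lemmas
import Mathlib.LinearAlgebra.Dimension.Constructions

/-!
# PneNP / ReslinSizeFromWidth — quadratic size–width law, part 1a: the common-subspace lemma

Helper file for the quadratic truncation of crux `ResLinSizeFromWidth` (stmt-PneNP-18932).
THE COMMON-SUBSPACE LEMMA: if `U₀, U₁, …, Uₘ` are subspaces of a finite-dimensional vector space
with `U_{i+1} ≤ U_i + ⟨e_i⟩` for every `i < m`, then for `j ≤ m` the intersection
`U_{m-j} ⊓ ⋯ ⊓ U_m` has dimension at least `dim U_m - j`.  Along a premise path of a Res(⊕)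
refutation the spaces of equations of the lines' falsifying flats form such a chain, so the last
`k` lines of a path to a line of rank `≥ k` share a common equation — the counting step of the
quadratic size–width law.
-/

namespace Summit.PneNP.PneNP.Theorems

-- `Summit.PneNP.PneNP` repeats a path component by design (summit = sub-problem); silence the linter.
set_option linter.dupNamespace false

namespace ResLinSW
-- BEGIN BODY

open Module Submodule

section CommonSubspace

variable {K M : Type*} [DivisionRing K] [AddCommGroup M] [Module K M]

/-- The iterated intersection `C U m j = U (m-j) ⊓ U (m-j+1) ⊓ ⋯ ⊓ U m`. -/
def commonInter (U : ℕ → Submodule K M) (m : ℕ) : ℕ → Submodule K M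
  | 0 => U m
  | j + 1 => U (m - (j + 1)) ⊓ commonInter U m j

/-- Members of the iterated intersection lie in each `U l`, `m - j ≤ l ≤ m`. -/
theorem mem_of_mem_commonInter {U : ℕ → Submodule K M} {m : ℕ} :
    ∀ {j : ℕ} {x : M}, x ∈ commonInter U m j → ∀ l, m - j ≤ l → l ≤ m → x ∈ U l
  | 0, x, hx, l, h1, h2 => by
    have : l = m := le_antisymm h2 (by simpa using h1)
    subst this
    exact hx
  | j + 1, x, hx, l, h1, h2 => by
    simp only [commonInter, Submodule.mem_inf] at hx
    by_cases hl : m - j ≤ l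
    · exact mem_of_mem_commonInter hx.2 l hl h2
    · have : l = m - (j + 1) := by omega
      subst this
      exact hx.1

/-- The iterated intersection lies inside `U m`. -/
theorem commonInter_le (U : ℕ → Submodule K M) (m : ℕ) : ∀ j, commonInter U m j ≤ U m
  | 0 => le_rfl
  | j + 1 => inf_le_right.trans (commonInter_le U m j)

/-- The iterated intersection lies inside its first member `U (m - j)`. -/
theorem commonInter_le_first (U : ℕ → Submodule K M) (m : ℕ) :
    ∀ j, commonInter U m j ≤ U (m - j)
  | 0 => by simp [commonInter]
  | _ + 1 => inf_le_left

variable [FiniteDimensional K M]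

/-- For `A ≤ B`: `dim (B ⊓ C) + dim A ≤ dim B + dim (A ⊓ C)` (the quotient `(B ⊓ C)/(A ⊓ C)`
embeds in `B/A`). -/
theorem finrank_inf_add_le_of_le {A B : Submodule K M} (hAB : A ≤ B) (C : Submodule K M) :
    finrank K ↥(B ⊓ C) + finrank K ↥A ≤ finrank K ↥B + finrank K ↥(A ⊓ C) := by
  have h := Submodule.finrank_sup_add_finrank_inf_eq A (B ⊓ C)
  have h1 : finrank K ↥(A ⊔ B ⊓ C) ≤ finrank K ↥B :=
    Submodule.finrank_mono (sup_le hAB inf_le_left)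
  have h2 : A ⊓ (B ⊓ C) = A ⊓ C := by
    rw [← inf_assoc, inf_eq_left.2 hAB]
  rw [h2] at h
  omega

/-- Two subspaces of `T` meet in dimension at least `dim X + dim Y - dim T`. -/
theorem finrank_add_le_finrank_inf_add {X Y T : Submodule K M} (hX : X ≤ T) (hY : Y ≤ T) :
    finrank K ↥X + finrank K ↥Y ≤ finrank K ↥(X ⊓ Y) + finrank K ↥T := by
  have h := Submodule.finrank_sup_add_finrank_inf_eq X Y
  have h1 : finrank K ↥(X ⊔ Y) ≤ finrank K ↥T := Submodule.finrank_mono (sup_le hX hY)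
  omega

/-- `dim (U ⊔ ⟨e⟩) ≤ dim U + 1`. -/
theorem finrank_sup_span_singleton_le (U : Submodule K M) (e : M) :
    finrank K ↥(U ⊔ K ∙ e) ≤ finrank K ↥U + 1 := by
  refine (Submodule.finrank_add_le_finrank_add_finrank _ _).trans ?_
  have : finrank K ↥(K ∙ e) ≤ 1 := by
    by_cases he : e = 0
    · rw [he, Submodule.span_zero_singleton, finrank_bot]
      exact zero_le_one
    · rw [finrank_span_singleton he]
  omega

/-- **Common-subspace lemma.** If `U (i+1) ≤ U i ⊔ ⟨e i⟩` for all `i < m`, then for `j ≤ m` the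
intersection `U (m-j) ⊓ ⋯ ⊓ U m` has dimension at least `dim (U m) - j`. -/
theorem finrank_le_finrank_commonInter_add (U : ℕ → Submodule K M) (e : ℕ → M) (m : ℕ)
    (h : ∀ i < m, U (i + 1) ≤ U i ⊔ K ∙ e i) :
    ∀ j ≤ m, finrank K ↥(U m) ≤ finrank K ↥(commonInter U m j) + j
  | 0, _ => by
    show finrank K ↥(U m) ≤ finrank K ↥(U m) + 0
    simp
  | j + 1, hj => by
    have ih := finrank_le_finrank_commonInter_add U e m h j (by omega)
    -- notation: i := m - (j+1), so i + 1 = m - j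
    set i := m - (j + 1) with hi
    have hi1 : i + 1 = m - j := by omega
    have him : i < m := by omega
    set V' : Submodule K M := U (i + 1) ⊓ U m with hV'
    set T : Submodule K M := (U i ⊔ K ∙ e i) ⊓ U m with hT
    have hT_le : finrank K ↥T + finrank K ↥(U i) ≤
        finrank K ↥(U i ⊔ K ∙ e i) + finrank K ↥(U i ⊓ U m) :=
      finrank_inf_add_le_of_le (le_sup_left : U i ≤ U i ⊔ K ∙ e i) (U m)
    have hsup : finrank K ↥(U i ⊔ K ∙ e i) ≤ finrank K ↥(U i) + 1 :=
      finrank_sup_span_singleton_le (U i) (e i)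
    -- both U i ⊓ U m and V' lie in T
    have hX1 : U i ⊓ U m ≤ T := inf_le_inf_right (U m) le_sup_left
    have hX2 : V' ≤ T := inf_le_inf_right (U m) (h i him)
    have hstep := finrank_add_le_finrank_inf_add hX1 hX2
    -- C j ≤ V'
    have hCj : commonInter U m j ≤ V' := by
      refine le_inf ?_ (commonInter_le U m j)
      have := commonInter_le_first U m j
      rwa [← hi1] at this
    have hfin := finrank_add_le_finrank_inf_add (inf_le_right : U i ⊓ U m ⊓ V' ≤ V') hCj
    -- C (j+1) = U i ⊓ C j ⊇ (U i ⊓ U m ⊓ V') ⊓ C j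
    have hC : U i ⊓ U m ⊓ V' ⊓ commonInter U m j ≤ commonInter U m (j + 1) := by
      show U i ⊓ U m ⊓ V' ⊓ commonInter U m j ≤ U (m - (j + 1)) ⊓ commonInter U m j
      rw [← hi]
      exact inf_le_inf_right _ (inf_le_left.trans inf_le_left)
    have hmono := Submodule.finrank_mono hC
    omega

end CommonSubspace

-- END BODY
end ResLinSW

end Summit.PneNP.PneNP.Theorems
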